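import Summits.BirchSwinnertonDyer.Rank1Residual.ManinAdditive.KummerCubeMonodromy
import Literature.NumberTheory.EllipticCurves.PeriodLatticeLevelRaisingProofs
import HarnessLib

/-!
# P79 and G0 from the `σ`-monodromy leaves (kernel-checked composition)

[Theorems] cell `bsd-f2-manin`, planner `-an` g37, MEMO-an §80.3; proposed tree path
`Summits/BirchSwinnertonDyer/BirchSwinnertonDyer/Theorems/ManinLocalTwoThreeKummerCubeMonodromy.lean`
(`--supports stmt-BirchSwinnertonDyer-22968`; landed by p2 g16 with the Theorems-side namespace
`Summit.BirchSwinnertonDyer.BirchSwinnertonDyer.Theorems.ManinLocalTwoThree.KummerCubeMonodromy`, statements unchanged).  The two imports are the tree modules (p718910, p718813; at writing: the PROPOSED tree modules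
(`KummerCubeMonodromy` = cell file `KummerSigmaMonodromy-an-g37.lean`; `PeriodLatticeLevelRaisingProofs` = cell file
`PeriodLatticeLevelRaising-an-g37.lean`)); the farm check of this composition was run on the concatenation
`KummerSigmaMonodromySim-an-g37.lean` (rc 0, 0 sorry).

`kummerCubeSeriesNotCubeAtThreeN_of_monodromy : S1 → S2 → S3 → S3b → S4 → S6 → S3′ → P79` and
`kummerCubeSeriesNotCubeAtN_of_monodromy : … → G0` — both through the level-uniform
`kummerCubeSeries_not_cube_of_level_mul` (`M = m·N`, `m ∣ N`), with S5 = the PROVED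
`closure_cuspSymbol_image_level_mul_eq_periodLattice`.  PARTITION unchanged · beyond-print theorem: no · BSD is not
proved by this.
-/

set_option autoImplicit false
-- lint-debt: the directory name repeats the summit name (sibling precedent `ManinLocalTwoThreeCubeRootDescent.lean`)
set_option linter.dupNamespace false

noncomputable section

open PowerSeries CongruenceSubgroup Complex
open scoped MatrixGroups ModularForm PeriodPair UpperHalfPlane
open WeierstrassCurve Literature.NumberTheory.EllipticCurves Literature.NumberTheory.EllipticCurves.ModularForms
open Summit.BirchSwinnertonDyer.Rank1Residual.ManinAdditive.CuspidalKummer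
open Summit.BirchSwinnertonDyer.Rank1Residual.ManinAdditive.CuspidalKummerThree

namespace Summit.BirchSwinnertonDyer.BirchSwinnertonDyer.Theorems.ManinLocalTwoThree.KummerCubeMonodromy

open Summit.BirchSwinnertonDyer.Rank1Residual.ManinAdditive.KummerCubeMonodromy

/-- **The level-uniform monodromy theorem.**  Under S1, S2, S3, S3b, S4, S6, S3′: for `m ∣ N` and a datum with the
lattice clause, the tangent-line Kummer series of a rational `3`-torsion point of the short model is not a cube in
`K_{mN}`. [cite: Manin1972, Thm. 1.9 (periods over Γ₀(mN) generate Λ_f; the rest is the cell's σ-monodromy, MEMO-an §80)] -/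
theorem kummerCubeSeries_not_cube_of_level_mul
    (h1 : KummerCubeAnalyticDictionary) (h2 : QExpansionCubeIdentityPrinciple)
    (h3 : SigmaTangentLineIdentity) (h3b : SigmaCubeRootNotPeriodic) (h4 : SigmaCubeRootMonodromy)
    (h6 : ShortThreeTorsionLift) (h7 : TangentLineScaling)
    (W : WeierstrassCurve ℚ) [W.IsElliptic] [W.IsGloballyMinimal] {N : ℕ} [NeZero N]
    (D : ModularParametrizationData W N) (a : ℕ → ℤ) (ha : ∀ n, (a n : ℂ) = cuspCoeff D.f n)
    {m : ℕ} [NeZero (m * N)] (hm : m ∣ N) (hLat : ∀ z ∈ D.L.lattice, ∃ w ∈ periodLattice D.f, z = D.c * w)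
    (X₀ Y₀ : ℚ) (hT : IsShortThreeTorsion W D.c X₀ Y₀) (z : ℚ⟦X⟧) (hz : IsParamGerm W D.c a z)
    (u : LaurentSeries ℂ) (hu : u ∈ modularFunctionField (m * N)) :
    HahnSeries.ofPowerSeries ℤ ℂ ((kummerCubeSeries W D.c X₀ Y₀ z).map (algebraMap ℚ ℂ)) ≠ u ^ 3 := by
  intro hcube
  -- S6: the torsion point is `P_s(p)`, `3p ∈ Λ ∌ p`, `℘'(p) ≠ 0`, `c ≠ 0`
  obtain ⟨hc0, p, hpΛ, h3p, h℘', hX, hY⟩ := h6 W D X₀ Y₀ hT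
  have hc0' : (D.c : ℂ) ≠ 0 := Int.cast_ne_zero.mpr hc0
  obtain ⟨m₁, m₂, hm12⟩ := PeriodPair.mem_lattice.mp h3p
  -- the representation `u = F̂/Ĝ` and the power-series identity `F̂³ = Θ·Ĝ³`
  obtain ⟨k, F, G, hG, hFG⟩ := (mem_modularFunctionField_iff (N := m * N)).mp hu
  set Θc : PowerSeries ℂ := (kummerCubeSeries W D.c X₀ Y₀ z).map (algebraMap ℚ ℂ) with hΘc
  have hPS : UpperHalfPlane.qExpansion 1 ⇑F ^ 3 = Θc * UpperHalfPlane.qExpansion 1 ⇑G ^ 3 := by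
    apply HahnSeries.ofPowerSeries_injective (Γ := ℤ) (R := ℂ)
    rw [map_pow, map_mul, map_pow, ← qExpansionL_def, ← qExpansionL_def, ← hFG, hcube]
    ring
  -- S1 + S2: `F³ = Θ^an·G³` near `i∞`
  obtain ⟨B, hB⟩ := h1 W D a ha hc0 X₀ Y₀ z hz
  have hcoef : ∀ τ : ℍ, B < τ.im →
      HasSum (fun n : ℕ ↦ coeff n Θc * Function.Periodic.qParam 1 (τ : ℂ) ^ n)
        (kummerCubeFunction D X₀ Y₀ τ) := by
    intro τ hτ
    have h := hB τ hτ
    simp only [hΘc, PowerSeries.coeff_map, eq_ratCast]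
    exact h
  have hFG3 := h2 (m * N) k F G Θc (kummerCubeFunction D X₀ Y₀) B hcoef hPS
  -- S3: the σ-cube root of the tangent line
  obtain ⟨C, hC0, hℓ⟩ := h3 D.L p m₁ m₂ hpΛ hm12.symm
  set e : ℂ := m₁ * D.L.η₁ + m₂ * D.L.η₂ with he
  -- S3′ + S3: the hypothesis of S4 with the constant `C·c³`
  have hS4 : ∀ τ : ℍ, B < τ.im → (D.c : ℂ) * eichlerIntegral D.f τ ∉ D.L.lattice →
      F τ ^ 3 = C * (D.c : ℂ) ^ 3 *
        (shortT D τ * sigmaCubeRoot D.L p e ((D.c : ℂ) * eichlerIntegral D.f τ)) ^ 3 * G τ ^ 3 := by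
    intro τ hτ hw
    rw [hFG3 τ hτ, h7 W D X₀ Y₀ p hX hY h℘' τ, hℓ _ hw]
    ring
  -- S4: monodromy
  have hper := h4 W D p e (m * N) k F G (C * (D.c : ℂ) ^ 3) B (dvd_mul_left N m) hG
    (mul_ne_zero hC0 (pow_ne_zero 3 hc0')) hS4
  -- the stabiliser of `W_p` is a subgroup containing the scaled periods over `Γ₀(N) ∩ Γ₀(mN)`, hence `Λ` (S5 + clause)
  let S : AddSubgroup ℂ :=
    { carrier := {l : ℂ | ∀ w₀ : ℂ, sigmaCubeRoot D.L p e (w₀ + l) = sigmaCubeRoot D.L p e w₀}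
      zero_mem' := fun w₀ ↦ by rw [add_zero]
      add_mem' := fun {l₁ l₂} hl₁ hl₂ w₀ ↦ by rw [← add_assoc, hl₂, hl₁]
      neg_mem' := fun {l} hl w₀ ↦ by
        have h := hl (w₀ + -l)
        rw [neg_add_cancel_right] at h
        exact h.symm }
  have hgen : (fun δ : Gamma0 N ↦ (D.c : ℂ) * cuspSymbol D.f δ) '' {δ : Gamma0 N | (δ : SL(2, ℤ)) ∈ Gamma0 (m * N)}
      ⊆ (S : Set ℂ) := by
    rintro _ ⟨δ, hδ, rfl⟩ w₀
    exact hper δ hδ w₀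
  have hΛS : ∀ l ∈ D.L.lattice, l ∈ S := by
    intro l hl
    have hle := le_closure_smul_cuspSymbol_image_level_mul D.f hm (D.c : ℂ) D.L.lattice.toAddSubgroup
      (fun z hz ↦ hLat z hz)
    exact (AddSubgroup.closure_le S).mpr hgen (hle hl)
  -- S3b: but `W_p` is not `Λ`-periodic
  obtain ⟨ω, hω, w, hne⟩ := h3b D.L p m₁ m₂ hpΛ hm12.symm
  exact hne (hΛS ω hω w)

/-- **P79 from the monodromy leaves** (`M = 3N`; `9 ∣ N` is used only through `3 ∣ N`).
[cite: Manin1972, Thm. 1.9 (shape; the composition is the cell's, MEMO-an §80)] -/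
theorem kummerCubeSeriesNotCubeAtThreeN_of_monodromy
    (h1 : KummerCubeAnalyticDictionary) (h2 : QExpansionCubeIdentityPrinciple)
    (h3 : SigmaTangentLineIdentity) (h3b : SigmaCubeRootNotPeriodic) (h4 : SigmaCubeRootMonodromy)
    (h6 : ShortThreeTorsionLift) (h7 : TangentLineScaling) :
    KummerCubeSeriesNotCubeAtThreeN := by
  intro W _ _ N _ D a ha h9 hLat X₀ Y₀ hT z hz u hu
  have h3N : 3 ∣ N := dvd_trans ⟨3, by norm_num⟩ h9
  exact kummerCubeSeries_not_cube_of_level_mul h1 h2 h3 h3b h4 h6 h7 W D a ha h3N hLat X₀ Y₀ hT z hz u hu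

/-- **G0 from the monodromy leaves** (`M = N`, `m = 1`). [cite: Manin1972, Thm. 1.9 (shape; the composition is the cell's, MEMO-an §80)] -/
theorem kummerCubeSeriesNotCubeAtN_of_monodromy
    (h1 : KummerCubeAnalyticDictionary) (h2 : QExpansionCubeIdentityPrinciple)
    (h3 : SigmaTangentLineIdentity) (h3b : SigmaCubeRootNotPeriodic) (h4 : SigmaCubeRootMonodromy)
    (h6 : ShortThreeTorsionLift) (h7 : TangentLineScaling) :
    KummerCubeSeriesNotCubeAtN := by
  intro W _ _ N _ D a ha h9 hLat X₀ Y₀ hT z hz u hu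
  haveI : NeZero (1 * N) := ⟨by rw [one_mul]; exact NeZero.ne N⟩
  have hu' : u ∈ modularFunctionField (1 * N) := by rwa [one_mul]
  exact kummerCubeSeries_not_cube_of_level_mul h1 h2 h3 h3b h4 h6 h7 W D a ha (one_dvd N) hLat X₀ Y₀ hT z hz u hu'

end Summit.BirchSwinnertonDyer.BirchSwinnertonDyer.Theorems.ManinLocalTwoThree.KummerCubeMonodromy

end
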